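import Literature.NumberTheory.LFunctions.ConreyIwaniec2002ThetaBinaryForms
import Literature.NumberTheory.LFunctions.ConreyIwaniec2002GenusCharByValues
import Literature.NumberTheory.Automorphic.BinaryThetaPoisson
import HarnessLib

/-!
# Conrey–Iwaniec (2002), (3.4) for `θ(z;ψ)` at the cusp `∞` (`c = 1`): the Fricke-type symmetry
# `(iy)⁻¹ θ(i/(√q y); ψ) = −i·θ(iy/√q; ψ)` — the `c = 1` instance of the `ω`-relation, kernel-checked

B. Conrey, H. Iwaniec, *Spacing of zeros of Hecke `L`-functions and the class number problem*,
Acta Arith. 103 (2002) 259–312, §§2–3 [held text `paper:arxiv-math_0111012`, p0006–p0009]: the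
weight-one forms `θ(z;ψ) = Σ_𝒜ψ(𝒜)θ_𝒜(z)` ((2.16)–(2.17)) satisfy, for `ω = (a√r, b/√r; c√r, d√r)`
(3.16), the relation `θ(·;ψ)|_ω = ηθ(·;ψψ_s)` whose pointwise form is (3.4):
`(iy)⁻¹ A(a/c + i/(Cy)) = η B(−d/c + iy/C)`, `C = c√r`, `s = (c,q)`, `r = q/s`, `|η| = 1`.

In the cell `landau-siegel/ls-inputs` this is the registered stub V1 `stub_theta_omega` of the
sub-skeleton `theta-voronoi` (typed with `IsOmegaRelated`, `thetaValue`, `thetaConst`,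
`IsGenusCharFor`). This file PROVES its **`c = 1` instance** (the cusp `∞`: `s = 1`, `r = q`,
`ψ_s = 1`, `a/c` and `−d/c` integers):

* `theta_omega_of_eq_one` — for `q > 4` odd with a primitive quadratic odd character, `K` with
  `[K:ℚ] = 2`, `d_K = −q`, every `ψ ∈ Ĉl(K)` and `c = 1`: there is `ψ'` (`= ψ`) with
  `IsGenusCharFor (ψ'ψ⁻¹) (1,q)` and, for all `a ā ≡ 1 (mod 1)`, an `η` (`= −i`) of modulus `1` with
  `IsOmegaRelated (1·√(q/1)) η λ_ψ λ_ψ' (thetaConst ψ) (thetaConst ψ') (a/1) (−ā·r̄/1)`, i.e.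
  `(iy)⁻¹ θ(a + i/(√q y); ψ) = −i·θ(−ā r̄ + iy/√q; ψ)` for all `y > 0` — the statement of V1 with
  `c := 1`, verbatim after `subst`.

Proof (the binary-theta route of the cell, at its simplest): both sides are
`½ Σ_{Q reduced} ψ̄([𝔞_Q]) θ_Q` (`thetaValue_twistCount_eq_half_sum_binaryTheta`, (2.15)–(2.17));
the real parts `a`, `−ā r̄` are integers and drop out; each `θ_Q(iY) = Σ e^{−2πYQ(v)}` satisfies
`θ_Q(iY) = (Y√q)⁻¹ θ_{Q̃}(i/(Yq))` (the tree's two-dimensional Poisson summation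
`tsum_exp_neg_congr_binaryQF` at modulus `1`, `Q̃ = (C, −B, A)`, `4AC − B² = q`), and
`θ_{Q̃} = θ_Q` (`Q̃(k₁,k₂) = Q(k₂, −k₁)`); with `Y = 1/(√q y)` this is
`θ(i/(√q y); ψ) = y·θ(iy/√q; ψ)`, and `(iy)⁻¹·y = −i`. The value `η = −i` agrees with the
numerical validation of V1 recorded on the cell's bus (S3-lead, `q = 23`, `(c,a) = (1,0)`).
Nothing is claimed about `c > 1` (which needs the quadratic Gauss sums of the forms).
«The programme SEARCHES and TYPES; no claim about Landau–Siegel zeros, Theorems 1–2 of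
arXiv:2211.02515 or a repaired Margin232 until a kernel theorem says so.»

## References

* [ConreyIwaniec2002] B. Conrey, H. Iwaniec, Acta Arith. 103 (2002) 259–312: §2 (2.15)–(2.17),
  §3 (3.3)–(3.4), (3.16).
* [Gunning1962] R. C. Gunning, *Lectures on Modular Forms* (1962), §20 (theta inversion).
-/

noncomputable section

open scoped NumberField FourierTransform
open Complex Module NumberField Ideal
open Literature.NumberTheory.QuadraticFields.BinaryQuadraticForm (reducedForms mem_reducedForms_iff)
open Literature.NumberTheory.QuadraticFields.Quadratic
open Literature.NumberTheory.Automorphic (tsum_exp_neg_congr_binaryQF)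

namespace Literature.NumberTheory.LFunctions

namespace ConreyIwaniec2002

open NumberField Literature.NumberTheory.LFunctions.NumberField

/-- `e((z + iY)n) = e^{−2πYn}` for integers `z, n` (private bookkeeping). [folklore] -/
private theorem cexp_two_pi_I_intCast_add (z : ℤ) (Y : ℝ) (n : ℤ) :
    cexp (2 * Real.pi * I * ((((z : ℝ) : ℝ) : ℂ) + (Y : ℂ) * I) * (n : ℂ)) =
      ((Real.exp (-(2 * Real.pi * Y) * (n : ℝ)) : ℝ) : ℂ) := by
  have hI : I * I = -1 := Complex.I_mul_I
  have h : 2 * Real.pi * I * ((((z : ℝ) : ℝ) : ℂ) + (Y : ℂ) * I) * (n : ℂ) =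
      ((z * n : ℤ) : ℂ) * (2 * Real.pi * I) + ((-(2 * Real.pi * Y) * (n : ℝ) : ℝ) : ℂ) := by
    push_cast
    linear_combination (2 * (Real.pi : ℂ) * Y * n) * hI
  rw [h, Complex.exp_add, Complex.exp_int_mul_two_pi_mul_I, one_mul, Complex.ofReal_exp]

/-- The Gaussian lattice sum is unchanged by `Q = (A, B, C) ↦ Q̃ = (C, −B, A)`
(`Q̃(k₁, k₂) = Q(k₂, −k₁)`); private reindexing. [folklore] -/
private theorem tsum_exp_dualForm_eq (k : ℝ) (A B C : ℤ) :
    (∑' p : ℤ × ℤ, ((Real.exp (k * ((C * p.1 ^ 2 - B * p.1 * p.2 + A * p.2 ^ 2 : ℤ) : ℝ)) : ℝ) : ℂ)) =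
      ∑' p : ℤ × ℤ, ((Real.exp (k * ((A * p.1 ^ 2 + B * p.1 * p.2 + C * p.2 ^ 2 : ℤ) : ℝ)) : ℝ) : ℂ) := by
  rw [← ((Equiv.prodComm ℤ ℤ).trans (Equiv.prodCongr (Equiv.refl ℤ) (Equiv.neg ℤ))).tsum_eq
    (fun p : ℤ × ℤ =>
      ((Real.exp (k * ((A * p.1 ^ 2 + B * p.1 * p.2 + C * p.2 ^ 2 : ℤ) : ℝ)) : ℝ) : ℂ))]
  refine tsum_congr fun p => ?_
  simp only [Equiv.trans_apply, Equiv.prodComm_apply, Equiv.prodCongr_apply, Equiv.coe_refl,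
    Prod.map_fst, Prod.map_snd, Prod.fst_swap, Prod.snd_swap, id_eq, Equiv.neg_apply]
  congr 4
  ring

/-- **The `c = 1` instance of the `ω`-relation for `θ(·;ψ)` (V1 `stub_theta_omega` at `c = 1`)**:
for `q > 4` odd carrying a primitive quadratic odd character, `K` with `[K:ℚ] = 2`, `d_K = −q`,
`ψ ∈ Ĉl(K)` and `c = 1`: `ψ' = ψ` has `IsGenusCharFor (ψ'ψ⁻¹) (gcd 1 q)` (`= 1`: the trivial
character), and for all `a, ā` (`aā ≡ 1 (mod 1)`), `η = −i` (`|η| = 1`) gives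
`IsOmegaRelated (1·√(q/1)) η λ_ψ λ_ψ (thetaConst ψ) (thetaConst ψ) (a/1) (−ā r̄/1)`, i.e.
`(iy)⁻¹ θ(a + i/(√q y); ψ) = −i θ(−ā r̄ + iy/√q; ψ)` for all `y > 0` — (3.4) for the matrix
`ω = (0, −1/√q; √q, 0)`-type inversion at the cusp `∞` composed with integer translations.
Binary-theta proof: (2.15)–(2.17) (`thetaValue_twistCount_eq_half_sum_binaryTheta`), Poisson
summation `θ_Q(iY) = (Y√q)⁻¹θ_{Q̃}(i/(Yq))` (`tsum_exp_neg_congr_binaryQF`, modulus `1`),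
`θ_{Q̃} = θ_Q`. [cite: ConreyIwaniec2002, §3 (3.3)–(3.4); §2 (2.15)–(2.17)] -/
theorem theta_omega_of_eq_one :
    ∀ (q : ℕ) [NeZero q], 4 < q → Odd q → ∀ χ : DirichletCharacter ℂ q,
      χ.IsPrimitive → χ.IsQuadratic → χ.Odd →
        ∀ (K : Type) [Field K] [NumberField K],
          Module.finrank ℚ K = 2 → NumberField.discr K = -(q : ℤ) →
            ∀ (ψ : ClassGroup (𝓞 K) →* ℂˣ) (c : ℕ), 1 ≤ c → c = 1 →
              ∃ ψ' : ClassGroup (𝓞 K) →* ℂˣ, IsGenusCharFor (ψ' * ψ⁻¹) (Nat.gcd c q) ∧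
                ∀ a abar : ℤ, a * abar ≡ 1 [ZMOD c] →
                  ∃ η : ℂ, ‖η‖ = 1 ∧
                    IsOmegaRelated ((c : ℝ) * Real.sqrt (q / Nat.gcd c q : ℕ)) η
                      (twistCount K (classGroupCharIdealHom ψ))
                      (twistCount K (classGroupCharIdealHom ψ'))
                      (thetaConst K ψ) (thetaConst K ψ')
                      ((a : ℝ) / c)
                      (-((abar * ((((q / Nat.gcd c q : ℕ) : ZMod c)⁻¹).val : ℤ) : ℤ) : ℝ) / c) := by
  intro q _ hq _ χ _ _ _ K _ _ h2 hdisc ψ c _ hc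
  classical
  subst hc
  refine ⟨ψ, ?_, ?_⟩
  · rw [show ψ * ψ⁻¹ = 1 from mul_inv_cancel ψ, Nat.gcd_one_left]
    exact (isGenusCharFor_one_iff (1 : ClassGroup (𝓞 K) →* ℂˣ)).mpr rfl
  intro a abar _
  refine ⟨-I, by simp, ?_⟩
  -- integral basis `(1, ω)`, `ω² = m + tω`, `d_K = t² + 4m = −q`
  obtain ⟨b, hb⟩ := exists_basis_zero_eq_one h2
  have hω := basis_one_mul_self_eq b hb
  have hdK := discr_eq_sq_add_four_mul b hb
  set m : ℤ := b.repr (b 1 * b 1) 0 with hm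
  set t : ℤ := b.repr (b 1 * b 1) 1 with ht
  have hDq : t ^ 2 + 4 * m = -(q : ℤ) := by rw [← hdK, hdisc]
  have hq0 : (0 : ℝ) < q := by exact_mod_cast (show 0 < q by omega)
  have hD : t ^ 2 + 4 * m < -4 := by rw [hDq]; omega
  have hneg : t ^ 2 + 4 * m < 0 := by linarith
  have hsq : 0 < Real.sqrt q := Real.sqrt_pos.mpr hq0
  have hsqq : Real.sqrt q * Real.sqrt q = q := Real.mul_self_sqrt hq0.le
  set ν : Ideal (𝓞 K) → ℂ := fun I => classGroupCharIdealHom ψ I with hν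
  -- the class-sum of binary theta series on the imaginary axis
  set T : ℝ → ℂ := fun Y => ∑ Q ∈ reducedForms (t ^ 2 + 4 * m),
      (ν (span {(Q.1 : 𝓞 K), b 1 - (((Q.2.1 + t) / 2 : ℤ) : 𝓞 K)}))⁻¹ *
        ∑' p : ℤ × ℤ, ((Real.exp (-(2 * Real.pi * Y) *
          ((Q.1 * p.1 ^ 2 + Q.2.1 * p.1 * p.2 + Q.2.2 * p.2 ^ 2 : ℤ) : ℝ)) : ℝ) : ℂ) with hT
  -- (i) `θ(z + iY; ψ) = ½ T(Y)` for an integer real part `z`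
  have hθ : ∀ (z : ℤ) {Y : ℝ}, 0 < Y →
      thetaValue (twistCount K (classGroupCharIdealHom ψ)) (thetaConst K ψ) (z : ℝ) Y =
        1 / 2 * T Y := by
    intro z Y hY
    rw [thetaValue_twistCount_eq_half_sum_binaryTheta b hb hω hD ψ (z : ℝ) hY, hT]
    congr 1
    refine Finset.sum_congr rfl fun Q _ => ?_
    congr 1
    exact tsum_congr fun p => cexp_two_pi_I_intCast_add z Y _
  -- (ii) the inversion `T(Y) = (Y√q)⁻¹ T(1/(Yq))`
  have hTinv : ∀ {Y : ℝ}, 0 < Y → T Y = (((Y * Real.sqrt q)⁻¹ : ℝ) : ℂ) * T (1 / (Y * q)) := by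
    intro Y hY
    rw [hT]
    simp only [Finset.mul_sum]
    refine Finset.sum_congr rfl fun Q hQ => ?_
    obtain ⟨hdQ, hA, -, -⟩ := (mem_reducedForms_iff hneg).1 hQ
    have hdQ' : Q.2.1 ^ 2 - 4 * Q.1 * Q.2.2 = t ^ 2 + 4 * m := hdQ
    have hdn : Q.2.1 ^ 2 - 4 * Q.1 * Q.2.2 < 0 := by rw [hdQ']; exact hneg
    have h4 : 4 * Q.1 * Q.2.2 - Q.2.1 ^ 2 = (q : ℤ) := by linarith
    have hw := tsum_exp_neg_congr_binaryQF Q.1 Q.2.1 Q.2.2 hA hdn 1 one_pos 0 0 hY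
    rw [h4] at hw
    simp only [Nat.cast_one, one_mul, add_zero, zero_mul, Int.cast_zero, zero_div,
      AddChar.map_zero_eq_one, Circle.coe_one, one_pow, Int.cast_natCast] at hw
    have hsum_eq : (∑' p : ℤ × ℤ, ((Real.exp (-(2 * Real.pi) / (Y * q) *
        ((Q.1 * p.1 ^ 2 + Q.2.1 * p.1 * p.2 + Q.2.2 * p.2 ^ 2 : ℤ) : ℝ)) : ℝ) : ℂ)) =
        ∑' p : ℤ × ℤ, ((Real.exp (-(2 * Real.pi * (1 / (Y * q))) *
          ((Q.1 * p.1 ^ 2 + Q.2.1 * p.1 * p.2 + Q.2.2 * p.2 ^ 2 : ℤ) : ℝ)) : ℝ) : ℂ) := by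
      refine tsum_congr fun p => ?_
      congr 2
      ring
    rw [mul_left_comm, hw, tsum_exp_dualForm_eq, hsum_eq]
  -- (iii) the relation at `c = 1`
  have key : ∀ (z₁ z₂ : ℤ) {y : ℝ}, 0 < y →
      (I * y)⁻¹ * thetaValue (twistCount K (classGroupCharIdealHom ψ)) (thetaConst K ψ) (z₁ : ℝ)
          (1 / (Real.sqrt q * y)) =
        -I * thetaValue (twistCount K (classGroupCharIdealHom ψ)) (thetaConst K ψ) (z₂ : ℝ)
          (y / Real.sqrt q) := by
    intro z₁ z₂ y hy
    have hY : 0 < 1 / (Real.sqrt q * y) := by positivity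
    have hy' : 0 < y / Real.sqrt q := by positivity
    rw [hθ z₁ hY, hθ z₂ hy', hTinv hY]
    have h1 : (1 / (Real.sqrt q * y) * Real.sqrt q)⁻¹ = y := by
      field_simp
    have h2' : 1 / (1 / (Real.sqrt q * y) * q) = y / Real.sqrt q := by
      rw [div_mul_eq_mul_div, one_mul, one_div_div,
        div_eq_div_iff (by positivity) hsq.ne']
      linear_combination y * hsqq
    rw [h1, h2']
    have hy0 : (y : ℂ) ≠ 0 := by exact_mod_cast hy.ne'
    rw [mul_inv, Complex.inv_I]
    field_simp
  intro y hy
  simp only [Nat.cast_one, one_mul, div_one, Nat.gcd_one_left, Nat.div_one]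
  have := key a (-(abar * ((((q : ℕ) : ZMod 1)⁻¹).val : ℤ))) hy
  simpa only [Int.cast_neg] using this

end ConreyIwaniec2002

end Literature.NumberTheory.LFunctions

end
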